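import Mathlib
import Summits.NavierStokesRegularity.NavierStokesRegularity.Theorems.SubcriticalEnvelopeForwardSourceTailEnvelopeKPTwoCycle
import Summits.NavierStokesRegularity.NavierStokesRegularity.Theorems.SubOnsagerCeilingForwardTailCeilingKPDyadicMidRange
import HarnessLib

/-!
# `SubcriticalEnvelope.ForwardSourceTailEnvelopeKP` (stmt-NavierStokesRegularity-27130) — the uniform
KP 2-cycle rung on the WIDE range `ε₀ ∈ [31/50, 1]` (helper file, `--supports`)

ns-soc-p2 g4's three-window certificate (`dyadicMidRange_shellBarrier`, `ε₀ ∈ [31/50, 18/25]`,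
p634397…p636695 + the wrapper `…KPDyadicMidRange.lean`) extends the one-mode chain rung below the
2-window floor.  Through the ratio-agnostic transfer `kpTwoCycle_shellBarrier_of_chain` (p636455) the
uniform KP 2-cycle inherits it verbatim, and with `kpTwoCycle_shellBarrier` (`[7/10,1]`) the whole
range `[31/50, 1]`:

* `kpTwoCycle_shellBarrier_midRange` — `ε₀ ∈ [31/50, 18/25]`, `θ = 101/200`, `D = 100`;
* `kpTwoCycleWide_shellBarrierAt : ∀ R, ∀ ε₀ ∈ [31/50, 1], ShellBarrierAt R ε₀ (kpTwoCycleTable c c)`;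
* `kpTwoCycleWide_ceilingAt` — the tail ceiling on the same range.

HONEST FRAMING: MODEL lattice statements (rung TL-M2Break); one architecture, one ratio range; the
cruxes 27057/27130 are NOT proved; nothing here concerns the Navier–Stokes equations.
-/

noncomputable section

-- the sub-problem namespace `NavierStokesRegularity.NavierStokesRegularity` is the tree's layout (D-0017)
set_option linter.dupNamespace false

namespace Summit.NavierStokesRegularity.NavierStokesRegularity.Theorems

open Set
open Literature.Analysis.FluidPDE.TaoCascade
open Summit.NavierStokesRegularity.NavierStokesRegularity.Theorems.SubOnsagerCeiling

/-- **Uniform KP 2-cycle, mid range `ε₀ ∈ [31/50, 18/25]`**: the ν-uniform weighted per-shell bound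
(`θ = 101/200`, `D = 100`), by the transfer applied to ns-soc-p2's `dyadicMidRange_shellBarrier`
(BY NAME).  MODEL lattice statement. [this file] -/
theorem kpTwoCycle_shellBarrier_midRange {c ε₀ : ℝ} (hc : 0 < c) (hε : 31 / 50 ≤ ε₀)
    (hε1 : ε₀ ≤ 18 / 25) :
    ∀ ν : ℝ, 0 < ν → ∀ (X₀ : Fin 4 → ℝ) (s : ℝ), 0 < s → ∀ X : Fin 4 → ℤ → ℝ → ℝ,
      (∀ (i : Fin 4) (k : ℤ), X i k 0 = if k = 0 then X₀ i else 0) →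
      (∀ (i : Fin 4) (k : ℤ), k < 0 → ∀ t : ℝ, X i k t = 0) →
      (∃ M : ℝ, ∀ (t : ℝ) (i : Fin 4) (k : ℤ), (1 + (1 + ε₀) ^ ((10 : ℝ) * k)) * |X i k t| ≤ M) →
      (∀ (i : Fin 4) (k : ℤ), Continuous (X i k)) →
      (∀ (i : Fin 4) (k : ℤ), ∀ t ∈ Set.Icc (0 : ℝ) s, HasDerivWithinAt (X i k)
        (quadTerm ε₀ (kpTwoCycleTable c c) X i k t - ν * (1 + ε₀) ^ ((2 : ℝ) * k) * X i k t)
        (Set.Icc (0 : ℝ) s) t) →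
      (∀ t ∈ Set.Icc (0 : ℝ) s, ∀ (i : Fin 4) (k : ℤ), 1 ≤ k → 0 ≤ X i k t) →
      ∀ t ∈ Set.Icc (0 : ℝ) s, ∀ (i : Fin 4) (k : ℕ),
        (1 + ε₀) ^ (2 * (101 / 200) * (k : ℝ)) * ((1 / 2 : ℝ) * X i (k : ℤ) t ^ 2) ≤
          100 * (∑ j : Fin 4, (1 / 2 : ℝ) * X₀ j ^ 2) :=
  kpTwoCycle_shellBarrier_of_chain (by linarith) (by norm_num)
    (dyadicMidRange_shellBarrier hc hε hε1 (α := fun i₁ i₂ i₃ μ => c * dyadicTable i₁ i₂ i₃ μ)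
      (fun _ _ _ _ => rfl))

/-- **The rung in binder shape on the WIDE range**: `ShellBarrierAt R ε₀ (kpTwoCycleTable c c)` for
every `R`, every `ε₀ ∈ [31/50, 1]`, every `c > 0` (case split at `18/25` vs `7/10`: the two
certified ranges overlap on `[7/10, 18/25]`). [this file] -/
theorem kpTwoCycleWide_shellBarrierAt {c : ℝ} (hc : 0 < c) :
    ∀ R : ℝ, ∀ ε₀ : ℝ, 31 / 50 ≤ ε₀ → ε₀ ≤ 1 → ShellBarrierAt R ε₀ (kpTwoCycleTable c c) := by
  intro R ε₀ hε hε1 _hT _hO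
  by_cases hmid : ε₀ ≤ 18 / 25
  · exact ⟨101 / 200, by norm_num, 100, by norm_num, kpTwoCycle_shellBarrier_midRange hc hε hmid⟩
  · exact ⟨101 / 200, by norm_num, 100, by norm_num,
      kpTwoCycle_shellBarrier hc (by linarith) hε1⟩

/-- **Tail ceiling for the uniform 2-cycle on `ε₀ ∈ [31/50, 1]`.** [this file] -/
theorem kpTwoCycleWide_ceilingAt {c : ℝ} (hc : 0 < c) :
    ∀ R : ℝ, ∀ ε₀ : ℝ, 31 / 50 ≤ ε₀ → ε₀ ≤ 1 → CeilingAt R ε₀ (kpTwoCycleTable c c) := by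
  intro R ε₀ hε hε1
  exact subOnsagerCeiling_ceilingAt_of_shellBarrierAt (by linarith)
    (kpTwoCycleWide_shellBarrierAt hc R ε₀ hε hε1)

end Summit.NavierStokesRegularity.NavierStokesRegularity.Theorems

end
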